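/-
Copyright (c) 2026. All rights reserved.
Released under Apache 2.0 license as described in the file LICENSE.
Authors: abc-iut cell, discharge seat abc-iut-w4-d020 (wave 4, D-0067 cone).
-/
import Literature.AnabelianGeometry.AbsoluteAnabelian.MonoAnalyticLogShells
import Literature.AnabelianGeometry.AbsoluteAnabelian.LogShellVolumes
import Mathlib.Analysis.SpecialFunctions.Complex.Arg
import Mathlib.Algebra.Module.ULift
import Mathlib.Topology.Constructions
import HarnessLib

/-!
# [AbsTopIII] Proposition 5.8 (iv)–(vi): the archimedean mono-analytic algorithm EXISTS — PROOF companion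

S. Mochizuki, *Topics in absolute anabelian geometry III: global reconstruction algorithms*,
J. Math. Sci. Univ. Tokyo 22 (2015) 939–1156 [MochizukiAbsTopIII2015], Prop 5.8 (iv)–(vi), manuscript pp. 140–141
(DAG nodes **AbsTopIII:Prop5.8(iv)**, **AbsTopIII:Prop5.8(v)**, **AbsTopIII:Prop5.8(vi)** of the abc-iut cell).

Proof-only companion to the LANDED statement file `MonoAnalyticLogShells.lean` (p404450, typer abc-iut-L4-t3; frozen,
not edited). There, Prop 5.8 (iv)–(vi) is typed as the HYPOTHESIS structure `MonoAnalyticArchAlgorithm`: "a functorial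
algorithm" `G = (C, C⃗) ↦ MonoAnalyticArch G` on `Ob(TM⊢)` (`TMMono`: topological monoids `C ≅ 𝒪_ℂ^▷` with a submonoid
`C⃗`) producing the pointed universal covering `C~ → C^×` (iv), the core segment `ℐ_{C~}` and the log-shell
`ℐ(G) ⊆ k~(G) = C~ × C~` (v), the line `R_arc(G)` with its Frobenius element and the radial/angular log-volumes with the
printed normalisation `μ^log(G)(ℐ(G)) = μ̆^log(G)(𝒪^×_{k~(G)}) - log 2·F(G)/2π = log π·F(G)/2π` (vi). Consumers were to
"take a term of this structure as a hypothesis".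

**Discharged here** (the printed item is an existence statement: "There is a functorial algorithm …"):
`nonempty_monoAnalyticArchAlgorithm : Nonempty MonoAnalyticArchAlgorithm`, via
`TMMono.exists_monoAnalyticArch_isNormalized : ∀ M : TMMono, ∃ A : MonoAnalyticArch M, A.IsNormalized`.
The construction, for `(C, C⃗) ∈ Ob(TM⊢)` with (a chosen witness of) `e : C ≅ 𝒪_ℂ^▷`:
* (iv) `C~ := ℝ` (as `ULift ℝ` in the universe of `C`), the universal covering `C~ → C^×`, `t ↦ e⁻¹(exp(it))` — a
  homomorphism (`exp` is), surjective because the units of `𝒪_ℂ^▷ = {0 < ‖z‖ ≤ 1}` are exactly the unit circle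
  (`norm_eq_one_of_mul_eq_one`) and `S¹ = exp(iℝ)` (`Complex.norm_eq_one_iff`);
* (v) `ℐ_{C~} := [-π, π] = [-1, 1]·x₀`, `x₀ = π`: invariant under `±1`, injective on `(-π, π)` (`exp_mul_I_injOn`, via
  `Complex.arg_exp_mul_I`), endpoints identified (`exp(iπ) = exp(-iπ)`); the log-shell `ℐ(G)` is then the typer's
  DEFINITION `MonoAnalyticArch.logShell`, and its image in the model `k~ ≅ ℂ`, `(x, y) ↦ x + iy`, is PROVED to be the
  tree's `ComplexLogShell.logShell` (`= closedBall 0 π`, LogShells.lean);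
* (vi) `R_arc(G) := ℝ` with `F(G) := 2π`; `∂ℐ_{C~} = {±π}` PROVED (`mem_coreBoundary_iff`: `exp(itπ) = exp(-itπ)`,
  `t ∈ [-1, 1] ∖ {0}` forces `t = ±1`), so `𝒪^×_{k~(G)}` (the typer's `MonoAnalyticArch.units`) maps onto the tree's
  `ComplexLogShell.units` (`= sphere 0 1`); the radial / angular log-volumes are the tree's `radialLogVolume` /
  `angularLogVolume` of [AbsTopIII] Prop 5.7 (ii) (LocalVolumesArchimedean.lean) transported along `k~(G) ≅ ℂ`, and
  the normalisation `IsNormalized` follows from `radialLogVolume_archLogShell` (`= log π`) and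
  `angularLogVolume_archUnits` (`= log 2π`) of LogShellVolumes.lean: `log π = log 2π - log 2`.

No new `def`, no named fact, nothing anabelian is assumed: the archimedean algorithm is classical complex analysis.
Refereed pre-IUT anabelian geometry; nothing here bears on [IUTchIII] Cor. 3.12; typed ≠ discharged elsewhere.
-/

set_option autoImplicit false

universe u

open Complex

namespace Literature.AnabelianGeometry.AbsoluteAnabelian

/-! ## Complex-analytic lemmas: the unit circle inside `𝒪_ℂ^▷` -/

/-- `exp(iθ) ∈ 𝒪_ℂ^▷` (it has norm `1`). [cite: MochizukiAbsTopIII2015, Prop 5.8 (iv) p. 140] -/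
theorem exp_mul_I_mem_complexIntegralMonoid (θ : ℝ) : Complex.exp (θ * I) ∈ complexIntegralMonoid := by
  change 0 < ‖Complex.exp (θ * I)‖ ∧ ‖Complex.exp (θ * I)‖ ≤ 1
  rw [Complex.norm_exp_ofReal_mul_I]
  exact ⟨one_pos, le_rfl⟩

/-- In `𝒪_ℂ^▷ = {0 < ‖z‖ ≤ 1}` an element with an inverse has norm `1` (the units of `𝒪_ℂ^▷` form the unit circle
`C^× ≅ S¹`). [cite: MochizukiAbsTopIII2015, Prop 5.8 (iv) p. 140] -/
theorem norm_eq_one_of_mul_eq_one {z w : ℂ} (hz : ‖z‖ ≤ 1) (hw : ‖w‖ ≤ 1) (h : z * w = 1) : ‖z‖ = 1 := by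
  have hzw : ‖z‖ * ‖w‖ = 1 := by rw [← norm_mul, h, norm_one]
  have hz0 : 0 ≤ ‖z‖ := norm_nonneg z
  nlinarith

/-- `exp(i·2tπ) = 1` with `t ∈ [-1, 1]`, `t ≠ 0` forces `t = ±1`. [cite: MochizukiAbsTopIII2015, Prop 5.8 (v) p. 140] -/
theorem eq_one_or_eq_neg_one_of_exp_eq {t : ℝ} (ht : t ∈ Set.Icc (-1 : ℝ) 1) (ht0 : t ≠ 0)
    (h : Complex.exp (↑(t * Real.pi) * I) = Complex.exp (↑(-(t * Real.pi)) * I)) : t = 1 ∨ t = -1 := by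
  obtain ⟨n, hn⟩ := Complex.exp_eq_exp_iff_exists_int.1 h
  have hre : t * Real.pi = -(t * Real.pi) + n * (2 * Real.pi) := by
    have := congrArg Complex.im hn
    simpa using this
  have ht' : t = n := by
    have hpi : Real.pi ≠ 0 := Real.pi_pos.ne'
    have : (t - n) * Real.pi = 0 := by linarith
    rcases mul_eq_zero.1 this with h1 | h1
    · linarith
    · exact absurd h1 hpi
  obtain ⟨h1, h2⟩ := ht
  have hn1 : (n : ℝ) ≤ 1 := ht' ▸ h2
  have hn2 : (-1 : ℝ) ≤ n := ht' ▸ h1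
  have hn0 : (n : ℝ) ≠ 0 := ht' ▸ ht0
  have : n = 1 ∨ n = -1 := by
    have a : n ≤ 1 := by exact_mod_cast hn1
    have b : -1 ≤ n := by exact_mod_cast hn2
    have c : n ≠ 0 := by exact_mod_cast hn0
    omega
  rcases this with rfl | rfl
  · left; simpa using ht'
  · right; simpa using ht'

/-- `θ ↦ exp(iθ)` is injective on `(-π, π)` (indeed on `(-π, π]`: `arg (exp(iθ)) = θ` there).
[cite: MochizukiAbsTopIII2015, Prop 5.8 (v) p. 140] -/
theorem exp_mul_I_injOn : Set.InjOn (fun θ : ℝ => Complex.exp (θ * I)) (Set.Ioo (-Real.pi) Real.pi) := by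
  intro a ha b hb hab
  have harg : ∀ θ : ℝ, θ ∈ Set.Ioo (-Real.pi) Real.pi → arg (Complex.exp (θ * I)) = θ := by
    intro θ hθ
    rw [Complex.arg_exp_mul_I, toIocMod_eq_self Real.two_pi_pos]
    exact ⟨hθ.1, by linarith [hθ.2]⟩
  have := congrArg arg hab
  simp only at this
  rwa [harg a ha, harg b hb] at this

/-- the endpoints of `ℐ_{C~} = [-π, π]` have the same image in `C^×`: `exp(iπ) = exp(-iπ)` (`= -1`).
[cite: MochizukiAbsTopIII2015, Prop 5.8 (v) p. 140] -/
theorem exp_pi_mul_I_eq_exp_neg_pi_mul_I : Complex.exp (↑Real.pi * I) = Complex.exp (↑(-Real.pi) * I) := by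
  refine Complex.exp_eq_exp_iff_exists_int.2 ⟨1, ?_⟩
  push_cast
  ring

/-! ## The construction: Prop 5.8 (iv)–(vi) for every `(C, C⃗) ∈ Ob(TM⊢)` -/

/-- **AbsTopIII:Prop5.8(iv)**, **AbsTopIII:Prop5.8(v)**, **AbsTopIII:Prop5.8(vi)** DISCHARGED (existence of the
archimedean algorithm with the printed normalisation): for every `G = (C, C⃗) ∈ Ob(TM⊢)` there is an output datum
`MonoAnalyticArch G` — universal covering `C~ → C^×`, core segment `ℐ_{C~}`, log-shell, `R_arc(G)` with `F(G) ↔ 2π`,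
radial/angular log-volumes — satisfying `μ^log(G)(ℐ(G)) = μ̆^log(G)(𝒪^×_{k~(G)}) - log 2 = log π` (read in `ℝ` via
`F(G) ↦ 2π`). Construction in the module docstring. [cite: MochizukiAbsTopIII2015, Prop 5.8 (iv)–(vi) pp. 140–141] -/
theorem TMMono.exists_monoAnalyticArch_isNormalized (M : TMMono.{u}) :
    ∃ A : MonoAnalyticArch M, A.IsNormalized := by
  obtain ⟨e, -, -⟩ := M.exists_iso
  -- (iv) the universal covering `C~ = ℝ → C^×`, `t ↦ e⁻¹(exp(it))`
  let expC : ℝ → complexIntegralMonoid := fun θ => ⟨Complex.exp (θ * I), exp_mul_I_mem_complexIntegralMonoid θ⟩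
  have expC_add : ∀ a b : ℝ, expC (a + b) = expC a * expC b := by
    intro a b
    apply Subtype.ext
    change Complex.exp (↑(a + b) * I) = Complex.exp (a * I) * Complex.exp (b * I)
    rw [← Complex.exp_add]
    push_cast
    ring_nf
  have expC_zero : expC 0 = 1 := Subtype.ext (by change Complex.exp ((0 : ℝ) * I) = 1; simp)
  have expC_mul_neg : ∀ a : ℝ, expC a * expC (-a) = 1 := by
    intro a; rw [← expC_add, add_neg_cancel, expC_zero]
  have expC_neg_mul : ∀ a : ℝ, expC (-a) * expC a = 1 := by
    intro a; rw [← expC_add, neg_add_cancel, expC_zero]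
  let cm : ULift.{u} ℝ → M.Cˣ := fun t =>
    ⟨e.symm (expC t.down), e.symm (expC (-t.down)),
      by rw [← map_mul, expC_mul_neg, map_one], by rw [← map_mul, expC_neg_mul, map_one]⟩
  have cm_val : ∀ t : ULift.{u} ℝ, (cm t : M.C) = e.symm (expC t.down) := fun _ => rfl
  have cm_eq_iff : ∀ s t : ULift.{u} ℝ, cm s = cm t ↔ Complex.exp (↑s.down * I) = Complex.exp (↑t.down * I) := by
    intro s t
    rw [Units.ext_iff, cm_val, cm_val, e.symm.apply_eq_iff_eq, Subtype.ext_iff]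
  -- (v) the core segment `ℐ_{C~} = [-1, 1]·π`
  let x₀ : ULift.{u} ℝ := ULift.up Real.pi
  let seg : Set (ULift.{u} ℝ) := {x | ∃ t : ℝ, t ∈ Set.Icc (-1 : ℝ) 1 ∧ x = t • x₀}
  have smul_x₀_down : ∀ t : ℝ, (t • x₀).down = t * Real.pi := fun t => rfl
  -- (vi) `R_arc(G) = ℝ` with Frobenius element `F(G) = 2π`
  let R : RLine.{u} :=
    { carrier := ULift.{u} ℝ
      frob := ULift.up (2 * Real.pi)
      frob_ne_zero := by
        intro h
        have := congrArg ULift.down h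
        simp only [ULift.zero_down] at this
        exact Real.two_pi_pos.ne' this
      exists_eq_smul := fun x => ⟨x.down / (2 * Real.pi), by
        apply ULift.ext
        simp only [ULift.smul_down, smul_eq_mul]
        rw [div_mul_cancel₀ _ Real.two_pi_pos.ne']⟩ }
  have R_toReal : ∀ x : ULift.{u} ℝ, R.toReal (2 * Real.pi) x = x.down := by
    intro x
    have h := congrArg ULift.down (R.coord_smul_frob x)
    change R.coord x * (2 * Real.pi) = x.down at h
    exact h
  -- the model map `k~(G) = C~ × C~ → ℂ`, `(x, y) ↦ x + iy`
  let toC : ULift.{u} ℝ × ULift.{u} ℝ → ℂ := fun z => (z.1.down : ℂ) + z.2.down * I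
  refine ⟨{ cover := ULift.{u} ℝ
            coverMap := cm
            coverMap_add := ?_
            coverMap_surjective := ?_
            coreSeg := seg
            neg_mem_coreSeg := ?_
            exists_endpoint := ⟨x₀, rfl, ?_, ?_⟩
            R := R
            radLogVol := fun S => ULift.up (ComplexVolume.radialLogVolume (toC '' S))
            angLogVol := fun S => ULift.up (ComplexVolume.angularLogVolume (toC '' S)) }, ?_⟩
  · -- `coverMap` is a homomorphism
    intro x y
    apply Units.ext
    change e.symm (expC (x + y).down) = e.symm (expC x.down) * e.symm (expC y.down)
    rw [← map_mul, ← expC_add]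
    rfl
  · -- `coverMap` is surjective: units of `𝒪_ℂ^▷` lie on `S¹ = exp(iℝ)`
    intro w
    have hmul : ((e (w : M.C) : complexIntegralMonoid) : ℂ) * (e (↑w⁻¹ : M.C) : ℂ) = 1 := by
      rw [← Submonoid.coe_mul, ← map_mul, Units.mul_inv, map_one, Submonoid.coe_one]
    have h1 : ‖((e (w : M.C) : complexIntegralMonoid) : ℂ)‖ = 1 :=
      norm_eq_one_of_mul_eq_one (e (w : M.C)).2.2 (e (↑w⁻¹ : M.C)).2.2 hmul
    obtain ⟨θ, hθ⟩ := (Complex.norm_eq_one_iff _).1 h1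
    refine ⟨ULift.up θ, Units.ext ?_⟩
    change e.symm (expC θ) = (w : M.C)
    rw [e.symm_apply_eq]
    exact Subtype.ext hθ
  · -- `ℐ_{C~}` is invariant under `±1`
    rintro x ⟨t, ht, rfl⟩
    exact ⟨-t, ⟨by linarith [ht.2], by linarith [ht.1]⟩, by rw [neg_smul]⟩
  · -- `C~ → C^×` is injective on the interior `(-1, 1)·π` of `ℐ_{C~}`
    rintro x ⟨s, hs, rfl⟩ y ⟨t, ht, rfl⟩ hxy
    rw [cm_eq_iff, smul_x₀_down, smul_x₀_down] at hxy
    have hsI : s * Real.pi ∈ Set.Ioo (-Real.pi) Real.pi :=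
      ⟨by nlinarith [hs.1, Real.pi_pos], by nlinarith [hs.2, Real.pi_pos]⟩
    have htI : t * Real.pi ∈ Set.Ioo (-Real.pi) Real.pi :=
      ⟨by nlinarith [ht.1, Real.pi_pos], by nlinarith [ht.2, Real.pi_pos]⟩
    have hst : s * Real.pi = t * Real.pi := exp_mul_I_injOn hsI htI hxy
    have : s = t := mul_right_cancel₀ Real.pi_pos.ne' hst
    rw [this]
  · -- the endpoints `±x₀` of `ℐ_{C~}` have the same image
    rw [cm_eq_iff]
    exact exp_pi_mul_I_eq_exp_neg_pi_mul_I
  · -- (vi) the normalisation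
    -- `∂ℐ_{C~} = {±π}`
    have mem_coreBoundary_iff : ∀ x : ULift.{u} ℝ,
        (x ∈ seg ∧ x ≠ 0 ∧ cm x = cm (-x)) ↔ (x.down = Real.pi ∨ x.down = -Real.pi) := by
      intro x
      constructor
      · rintro ⟨⟨t, ht, rfl⟩, hx0, hcm⟩
        rw [cm_eq_iff, ULift.neg_down, smul_x₀_down] at hcm
        have ht0 : t ≠ 0 := by
          rintro rfl
          exact hx0 (by rw [zero_smul])
        rcases eq_one_or_eq_neg_one_of_exp_eq ht ht0 hcm with rfl | rfl
        · left; rw [smul_x₀_down, one_mul]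
        · right; rw [smul_x₀_down, neg_one_mul]
      · intro hx
        have hx' : x = (1 : ℝ) • x₀ ∨ x = (-1 : ℝ) • x₀ := by
          rcases hx with h | h
          · left; apply ULift.ext; rw [smul_x₀_down, one_mul]; exact h
          · right; apply ULift.ext; rw [smul_x₀_down, neg_one_mul]; exact h
        refine ⟨?_, ?_, ?_⟩
        · rcases hx' with h | h
          · exact ⟨1, ⟨by norm_num, le_rfl⟩, h⟩
          · exact ⟨-1, ⟨le_rfl, by norm_num⟩, h⟩
        · intro h0
          have := congrArg ULift.down h0
          rw [ULift.zero_down] at this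
          rcases hx with h | h <;> rw [h] at this <;> linarith [Real.pi_pos]
        · rw [cm_eq_iff, ULift.neg_down]
          rcases hx with h | h
          · rw [h]; exact exp_pi_mul_I_eq_exp_neg_pi_mul_I
          · rw [h, neg_neg]; exact exp_pi_mul_I_eq_exp_neg_pi_mul_I.symm
    -- the image of `ℐ(G)` in `ℂ` is the tree's archimedean log-shell `closedBall 0 π`
    have image_logShell :
        toC '' {z : ULift.{u} ℝ × ULift.{u} ℝ | ∃ (a b : ℝ) (x : ULift.{u} ℝ),
          x ∈ seg ∧ a ^ 2 + b ^ 2 = 1 ∧ z = (a • x, b • x)} = ComplexLogShell.logShell := by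
      ext z
      simp only [Set.mem_image, Set.mem_setOf_eq, ComplexLogShell.logShell, ComplexLogShell.coreSegment]
      constructor
      · rintro ⟨_, ⟨a, b, x, ⟨t, ht, rfl⟩, hab, rfl⟩, rfl⟩
        refine ⟨a, b, t * Real.pi, ⟨by nlinarith [ht.1, Real.pi_pos], by nlinarith [ht.2, Real.pi_pos]⟩,
          hab, ?_⟩
        change ((a • t • x₀).down : ℂ) + ((b • t • x₀).down : ℝ) * I = _
        simp only [ULift.smul_down, smul_eq_mul]
        push_cast
        ring
      · rintro ⟨a, b, x, hx, hab, rfl⟩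
        refine ⟨(a • (x / Real.pi) • x₀, b • (x / Real.pi) • x₀), ⟨a, b, (x / Real.pi) • x₀,
          ⟨x / Real.pi, ⟨?_, ?_⟩, rfl⟩, hab, rfl⟩, ?_⟩
        · rw [le_div_iff₀ Real.pi_pos]; linarith [hx.1]
        · rw [div_le_iff₀ Real.pi_pos]; linarith [hx.2]
        · change ((a • (x / Real.pi) • x₀).down : ℂ) + ((b • (x / Real.pi) • x₀).down : ℝ) * I = _
          simp only [ULift.smul_down, smul_eq_mul]
          rw [div_mul_cancel₀ _ Real.pi_pos.ne']
          push_cast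
          ring
    -- the image of `𝒪^×_{k~(G)}` in `ℂ` is the tree's `ComplexLogShell.units` (the unit circle)
    have image_units :
        toC '' {z : ULift.{u} ℝ × ULift.{u} ℝ | ∃ (a b : ℝ) (x : ULift.{u} ℝ),
          (x ∈ seg ∧ x ≠ 0 ∧ cm x = cm (-x)) ∧ a ^ 2 + b ^ 2 = (Real.pi ^ 2)⁻¹ ∧ z = (a • x, b • x)} =
          ComplexLogShell.units := by
      ext z
      simp only [Set.mem_image, Set.mem_setOf_eq, ComplexLogShell.units, mem_coreBoundary_iff]
      constructor
      · rintro ⟨_, ⟨a, b, x, hx, hab, rfl⟩, rfl⟩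
        refine ⟨a, b, x.down, hx, hab, ?_⟩
        change ((a • x).down : ℂ) + ((b • x).down : ℝ) * I = _
        simp only [ULift.smul_down, smul_eq_mul]
        push_cast
        ring
      · rintro ⟨a, b, x, hx, hab, rfl⟩
        refine ⟨(a • ULift.up x, b • ULift.up x), ⟨a, b, ULift.up x, hx, hab, rfl⟩, ?_⟩
        change ((a • ULift.up.{u} x).down : ℂ) + ((b • ULift.up.{u} x).down : ℝ) * I = _
        simp only [ULift.smul_down, smul_eq_mul]
        push_cast
        ring
    -- conclude
    change R.toReal (2 * Real.pi) (ULift.up (ComplexVolume.radialLogVolume (toC '' _))) =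
        R.toReal (2 * Real.pi) (ULift.up (ComplexVolume.angularLogVolume (toC '' _))) - Real.log 2 ∧
      R.toReal (2 * Real.pi) (ULift.up (ComplexVolume.radialLogVolume (toC '' _))) = Real.log Real.pi
    rw [R_toReal, R_toReal]
    change ComplexVolume.radialLogVolume (toC '' {z | ∃ (a b : ℝ) (x : ULift.{u} ℝ),
          x ∈ seg ∧ a ^ 2 + b ^ 2 = 1 ∧ z = (a • x, b • x)}) =
        ComplexVolume.angularLogVolume (toC '' {z | ∃ (a b : ℝ) (x : ULift.{u} ℝ),
          (x ∈ seg ∧ x ≠ 0 ∧ cm x = cm (-x)) ∧ a ^ 2 + b ^ 2 = (Real.pi ^ 2)⁻¹ ∧ z = (a • x, b • x)})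
          - Real.log 2 ∧
      ComplexVolume.radialLogVolume (toC '' {z | ∃ (a b : ℝ) (x : ULift.{u} ℝ),
          x ∈ seg ∧ a ^ 2 + b ^ 2 = 1 ∧ z = (a • x, b • x)}) = Real.log Real.pi
    rw [image_logShell, image_units, radialLogVolume_archLogShell, angularLogVolume_archUnits,
      ComplexLogShell.logShellRadialLogVolume, ComplexLogShell.unitsAngularLogVolume,
      Real.log_mul two_ne_zero Real.pi_pos.ne']
    exact ⟨by ring, rfl⟩

/-- **AbsTopIII:Prop5.8(iv)**–**(vi)**: the hypothesis structure `MonoAnalyticArchAlgorithm` ("a functorial algorithm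
`G ↦ MonoAnalyticArch G` on `Ob(TM⊢)` satisfying the printed normalisation") is INHABITED — consumers that took a term of
it as a hypothesis toward a `Prop` may discharge that hypothesis with this theorem.
[cite: MochizukiAbsTopIII2015, Prop 5.8 (iv)–(vi) pp. 140–141] -/
theorem nonempty_monoAnalyticArchAlgorithm : Nonempty MonoAnalyticArchAlgorithm.{u} :=
  ⟨{ out := fun M => (TMMono.exists_monoAnalyticArch_isNormalized M).choose
     isNormalized := fun M => (TMMono.exists_monoAnalyticArch_isNormalized M).choose_spec }⟩

end Literature.AnabelianGeometry.AbsoluteAnabelian
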